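import Summits.QuantumFields.YangMills.Theorems.ParabolicTrajectoryContinuumLimitOnTrajectoryUclDefs
import Summits.QuantumFields.YangMills.Theorems.ParabolicTrajectoryContinuumLimitOnTrajectoryUclAlg

/-!
# Crux `ContinuumLimitOnTrajectory` (stmt-QuantumFields-10522), line `two-orbit-synchronisation` (seat c2):
# the core clustering estimate from its main term and its tail terms

Helper file (`--supports stmt-QuantumFields-10522`) for the registered stub `stub_uclOfGap : UCLOfGap` (skeleton v3.1).
Pure assembly: `CoreClustering r sch` (…UclDefs) follows from the MAIN-TERM bound (`MainTermAt r sch`, the instantiated statement of the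
wave-2 helper `main_term_bound`) and the TAIL-TERMS bound (`TailTermsAt r sch`, the instantiated statement of `tail_terms_bound`) by the
nine-term expansion of the truncated two-block functional `covc` (…UclAlg) along the three-piece decompositions of …UclDefs, plus the
support bookkeeping that keeps every translate `Low ⊗ T_{tb} Up` locus-avoiding (`avoidsLocus_appendTensor_of_sepP`).
-/

set_option autoImplicit false

open scoped SchwartzMap ComplexConjugate
open MeasureTheory Filter Topology Set
open Literature.MathematicalPhysics.QuantumFieldTheory Literature.MathematicalPhysics.QuantumLattice
open Literature.MathematicalPhysics.AQFT Literature.Probability.LatticeModels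
open Summit.QuantumFields.YangMills.Cruxes.LatticeGapOnTrajectory.OrbitKantorovichFiniteSize.Transfer (TorusOSGap)

noncomputable section

namespace Summit.QuantumFields.YangMills.Cruxes.ContinuumLimitOnTrajectory.TwoOrbitSynchronisation

local notation "𝔼" => EuclideanSpace ℝ (Fin 4)

variable {G : Type} [Group G] [TopologicalSpace G] [IsTopologicalGroup G] [CompactSpace G]
  [MeasurableSpace G] [BorelSpace G]

/-- **The main-term bound at `(r, sch)`** (the body of the wave-2 helper `main_term_bound`). -/
def MainTermAt (r : LatticeRep G) (sch : SpeciesScheme (YMSpecies G)) : Prop :=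
  ∀ Δ' : ℝ, 0 < Δ' → TorusOSGap r sch Δ' → UUVB r sch → VarBound r sch →
  ∀ (n₁ n₂ : ℕ) (Low : 𝓢((Fin n₁ → 𝔼), ℂ)) (Up : 𝓢((Fin n₂ → 𝔼), ℂ)) (b : 𝔼),
  AvoidsLocus Low → AvoidsLocus Up → 0 < b 0 → (∀ t : ℝ, AvoidsLocus (Low.appendTensor (translateMulti (t • b) Up))) →
  ∀ ε : ℝ, 0 < ε → ∃ t₀ : ℝ, ∀ t : ℝ, t₀ ≤ t → ∀ᶠ k in atTop,
    ‖curvDistribution r sch k (n₁ + n₂) ((lowMain (rhoK sch k) (t * b 0) Low).appendTensor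
          (upMain (rhoK sch k) (t * b 0) (translateMulti (t • b) Up))) -
        curvDistribution r sch k n₁ (lowMain (rhoK sch k) (t * b 0) Low) *
          curvDistribution r sch k n₂ (upMain (rhoK sch k) (t * b 0) (translateMulti (t • b) Up))‖ ≤ ε

/-- **The tail-terms bound at `(r, sch)`** (the body of the wave-2 helper `tail_terms_bound`). -/
def TailTermsAt (r : LatticeRep G) (sch : SpeciesScheme (YMSpecies G)) : Prop :=
  PolyVolumeGrowth sch → UUVB r sch →
  ∀ (n₁ n₂ : ℕ) (Low : 𝓢((Fin n₁ → 𝔼), ℂ)) (Up : 𝓢((Fin n₂ → 𝔼), ℂ)) (b : 𝔼),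
  AvoidsLocus Low → AvoidsLocus Up → 0 < b 0 → (∀ t : ℝ, AvoidsLocus (Low.appendTensor (translateMulti (t • b) Up))) →
  ∀ ε : ℝ, 0 < ε → ∃ t₀ : ℝ, ∀ t : ℝ, t₀ ≤ t → ∀ᶠ k in atTop,
    ‖covc r sch k (lowMain (rhoK sch k) (t * b 0) Low) (upMid (rhoK sch k) (t * b 0) (translateMulti (t • b) Up))‖ ≤ ε / 8 ∧
    ‖covc r sch k (lowMain (rhoK sch k) (t * b 0) Low) (upFar (rhoK sch k) (t * b 0) (translateMulti (t • b) Up))‖ ≤ ε / 8 ∧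
    ‖covc r sch k (lowMid (rhoK sch k) (t * b 0) Low) (upMain (rhoK sch k) (t * b 0) (translateMulti (t • b) Up))‖ ≤ ε / 8 ∧
    ‖covc r sch k (lowMid (rhoK sch k) (t * b 0) Low) (upMid (rhoK sch k) (t * b 0) (translateMulti (t • b) Up))‖ ≤ ε / 8 ∧
    ‖covc r sch k (lowMid (rhoK sch k) (t * b 0) Low) (upFar (rhoK sch k) (t * b 0) (translateMulti (t • b) Up))‖ ≤ ε / 8 ∧
    ‖covc r sch k (lowFar (rhoK sch k) Low) (upMain (rhoK sch k) (t * b 0) (translateMulti (t • b) Up))‖ ≤ ε / 8 ∧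
    ‖covc r sch k (lowFar (rhoK sch k) Low) (upMid (rhoK sch k) (t * b 0) (translateMulti (t • b) Up))‖ ≤ ε / 8 ∧
    ‖covc r sch k (lowFar (rhoK sch k) Low) (upFar (rhoK sch k) (t * b 0) (translateMulti (t • b) Up))‖ ≤ ε / 8

/-! ## Separation by a coordinate predicate -/

/-- **Separated locus-avoiding factors have a locus-avoiding tensor product** (predicate form): if the values of the coordinate `crd` on
the support of `F` satisfy `P` and those on the support of `G'` satisfy `¬P`, the appended tensor avoids the locus of `n + m` points. -/
theorem avoidsLocus_appendTensor_of_sepP {n m : ℕ} {F : 𝓢((Fin n → 𝔼), ℂ)} {G' : 𝓢((Fin m → 𝔼), ℂ)} (hF : AvoidsLocus F)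
    (hG : AvoidsLocus G') (crd : Fin 4) (P : ℝ → Prop) (hFc : tsupport (F : (Fin n → 𝔼) → ℂ) ⊆ {x | ∀ j, P (x j crd)})
    (hGc : tsupport (G' : (Fin m → 𝔼) → ℂ) ⊆ {y | ∀ j, ¬ P (y j crd)}) : AvoidsLocus (F.appendTensor G') := by
  intro x hx hxl
  obtain ⟨h1, h2⟩ := tsupport_appendTensor_subset_preimage F G' hx
  obtain ⟨i, j, hij, hxij⟩ := hxl
  induction i using Fin.addCases with
  | left i =>
    induction j using Fin.addCases with
    | left j =>
      refine hF h1 ⟨i, j, fun h => hij (by rw [h]), ?_⟩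
      simpa [Function.comp_def] using hxij
    | right j =>
      have a1 := hFc h1 i
      have a2 := hGc h2 j
      simp only [Function.comp_apply] at a1 a2
      rw [hxij] at a1
      exact a2 a1
  | right i =>
    induction j using Fin.addCases with
    | left j =>
      have a1 := hGc h2 i
      have a2 := hFc h1 j
      simp only [Function.comp_apply] at a1 a2
      rw [hxij] at a1
      exact a1 a2
    | right j =>
      refine hG h2 ⟨i, j, fun h => hij (by rw [h]), ?_⟩
      simpa [Function.comp_def] using hxij

/-- Every translate along `b` with `b crd = 0` of the separated upper factor keeps the appended tensor locus-avoiding. -/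
theorem avoidsLocus_appendTensor_translate {n m : ℕ} {Low : 𝓢((Fin n → 𝔼), ℂ)} {Up : 𝓢((Fin m → 𝔼), ℂ)} (hL : AvoidsLocus Low)
    (hU : AvoidsLocus Up) (crd : Fin 4) (P : ℝ → Prop) (hLc : tsupport (Low : (Fin n → 𝔼) → ℂ) ⊆ {x | ∀ j, P (x j crd)})
    (hUc : tsupport (Up : (Fin m → 𝔼) → ℂ) ⊆ {y | ∀ j, ¬ P (y j crd)}) (b : 𝔼) (hb : b crd = 0) (t : ℝ) :
    AvoidsLocus (Low.appendTensor (translateMulti (t • b) Up)) := by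
  refine avoidsLocus_appendTensor_of_sepP hL (hU.translateMulti (t • b)) crd P hLc ?_
  exact tsupport_translateMulti_subset_of_coord_eq_zero (t • b) crd (by simp [hb]) Up (P := fun s => ¬ P s) hUc

/-! ## The assembly -/

/-- **Core clustering from the main term and the tails.** -/
theorem coreClustering_of :
    ∀ {G : Type} [Group G] [TopologicalSpace G] [IsTopologicalGroup G] [CompactSpace G] [MeasurableSpace G] [BorelSpace G]
      (r : LatticeRep G) (sch : SpeciesScheme (YMSpecies G)) {Δ' : ℝ}, 0 < Δ' → TorusOSGap r sch Δ' → UUVB r sch → VarBound r sch →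
      PolyVolumeGrowth sch → MainTermAt r sch → TailTermsAt r sch → CoreClustering r sch := by
  intro G _ _ _ _ _ _ r sch Δ' hΔ' hgap hU hV hGr hM hT n₁ n₂ Low Up hL hUp crd hcrd P hLc hUc b hb0 hbcrd ε hε
  have hav : ∀ t : ℝ, AvoidsLocus (Low.appendTensor (translateMulti (t • b) Up)) :=
    avoidsLocus_appendTensor_translate hL hUp crd P hLc hUc b hbcrd
  obtain ⟨t₁, ht₁⟩ := hM Δ' hΔ' hgap hU hV n₁ n₂ Low Up b hL hUp hb0 hav (ε / 2) (half_pos hε)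
  obtain ⟨t₂, ht₂⟩ := hT hGr hU n₁ n₂ Low Up b hL hUp hb0 hav (ε / 2) (half_pos hε)
  refine ⟨max t₁ t₂, fun t ht => ?_⟩
  have h1 := ht₁ t ((le_max_left _ _).trans ht)
  have h2 := ht₂ t ((le_max_right _ _).trans ht)
  filter_upwards [h1, h2] with k hk1 hk2
  obtain ⟨e1, e2, e3, e4, e5, e6, e7, e8⟩ := hk2
  set ρ := rhoK sch k
  set s := t * b 0
  set Y := translateMulti (t • b) Up
  have h9 := norm_covc_sum3_le r sch k (lowMain ρ s Low) (lowMid ρ s Low) (lowFar ρ Low) (upMain ρ s Y) (upMid ρ s Y) (upFar ρ s Y)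
  rw [lowMain_add_lowMid_add_lowFar, upMain_add_upMid_add_upFar] at h9
  have hmain : ‖covc r sch k (lowMain ρ s Low) (upMain ρ s Y)‖ ≤ ε / 2 := hk1
  change ‖covc r sch k Low Y‖ ≤ ε
  linarith

end Summit.QuantumFields.YangMills.Cruxes.ContinuumLimitOnTrajectory.TwoOrbitSynchronisation

end
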